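import Literature.AlgebraicGeometry.Frobenioids.Thm49OfPreSteps
import Literature.AlgebraicGeometry.Frobenioids.Thm49CompatAssemblyWeak
import Literature.AlgebraicGeometry.Frobenioids.Thm42SubWeakConstructors
import HarnessLib

/-!
# [FrdI] Theorem 4.9 AS TYPED (`PreFrobenioidData.Thm49` at `ofFunctor`), in print's generality, modulo only
# "`Ψ`, `Ψ⁻¹` preserve pre-steps" — WEAKLY perf-factorial divisor monoids

Mochizuki, *The geometry of Frobenioids I: the general theory*, Kyushu J. Math. **62** (2008)
293–400, §4, Theorem 4.9, statement p. 88 l. 33 – p. 89 l. 2, proof p. 89 l. 3 – p. 90 l. 54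
[cite: MochizukiFrdI2008, Thm. 4.9 p.88]; Theorem 3.4 (ii) p. 62.

PROOF-ONLY file (cell abc-iut, layer L1, seat abc-iut-L1-t14; row «T49-ASPRINTED-WEAK» = the typed Thm. 4.9 row
over `IsPerfFactorialWeak`). WEAK-HYPOTHESIS TWIN of `FrdI.T49.thm49_ofFunctor_of_preservesPreSteps`
(`Thm49OfPreSteps.lean`, seat abc-iut-L1-d6 / abc-iut-w4-d109) with "`Φ_i` perf-factorial" (Def. 2.4 (i) (a)–(d))
weakened to "`Φ_i` weakly perf-factorial" (`IsPerfFactorialWeak`; cell finding F-L2d2-1):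
`FrdI.T49.thm49_ofFunctor_of_preservesPreSteps_weak` — the typed `Thm49` for Frobenioids `C_i → F_{Φ_i}` with
WEAKLY perf-factorial `Φ_i`, `C₁` of rational type at THE birationalization / support, `Ψ`, `Ψ⁻¹` preserving
pre-steps, arbitrary `R_i : RSParams`. Route verbatim: group-like case (hypothesis-free), isotropifications, the
WEAK setting at THE perfections (`FrdI.T42.settingWeak_perfection_asPrinted`, `Thm42SubWeakConstructors.lean`),
Thm. 4.9 with compatibility there (`exists_thm49_compat_perfect_primarySupp_weak`, `Thm49CompatAssemblyWeak.lean`),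
the hypothesis-free descent / isotropic extension, and the hypothesis-free group-like transport
`isGroupLikeObj_map_of_preservesPreSteps` of the strong file (consumed BY NAME). No new definitions; nothing of the
paper restated or strengthened; nothing here is specific to the abc programme and no side is taken on [IUTchIII]
Cor. 3.12.
-/

namespace Literature.AlgebraicGeometry.Frobenioids


namespace FrdI.T49

open CategoryTheory Opposite PreFrobenioidData

universe w v v' u u'

variable {D₁ : Type u} [Category.{v} D₁] {Φ₁ : D₁ᵒᵖ ⥤ CommMonCat.{w}} {C₁ : Type u'} [Category.{v'} C₁]
  {D₂ : Type u} [Category.{v} D₂] {Φ₂ : D₂ᵒᵖ ⥤ CommMonCat.{w}} {C₂ : Type u'} [Category.{v'} C₂]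
  {F₁ : C₁ ⥤ ElemFrobenioid Φ₁} {F₂ : C₂ ⥤ ElemFrobenioid Φ₂}


set_option backward.isDefEq.respectTransparency false in
/-- (WEAK monoids: `Φ_i` weakly perf-factorial; twin of `thm49_ofFunctor_of_preservesPreSteps`.) **[FrdI] Theorem 4.9 AS TYPED (`PreFrobenioidData.Thm49` at `ofFunctor`), in print's generality, MODULO ONLY
"`Ψ`, `Ψ⁻¹` preserve pre-steps"** (Thm. 3.4 (ii)): for Frobenioids `C_i → F_{Φ_i}` with perf-factorial `Φ_i`, `C₁`
of rational type at THE birationalization / support (`hrat₁`), and an equivalence `Ψ : C₁ ⥲ C₂` such that `Ψ` and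
`Ψ⁻¹` preserve pre-steps: if the `C_i` are of rationally standard type there is an isomorphism of functors
`Ψ^Φ : Φ₁ ⥲ Φ₂` lying over `Ψ`. No hypothesis on the bases beyond print's standard type (Def. 3.1 (i)(d)).
Proof = print's / seat abc-iut-w4-d109's assembly with the base-free transports (see the module docstring).
[cite: MochizukiFrdI2008, Thm. 4.9 p.88] -/
theorem thm49_ofFunctor_of_preservesPreSteps_weak (hF₁ : PreFrobenioid.IsFrobenioid F₁)
    (hF₂ : PreFrobenioid.IsFrobenioid F₂)
    (hpf₁ : Objectwise (fun M _ => IsPerfFactorialWeak M) Φ₁) (hpf₂ : Objectwise (fun M _ => IsPerfFactorialWeak M) Φ₂)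
    (hrat₁ : ∀ A : C₁, PreFrobenioidData.IsRational
      (PreFrobenioid.biratData hF₁ (PreFrobenioid.hasBiratSquares_of_isFrobenioid hF₁))
      (S := ofFunctor Φ₁ F₁) (fun a 𝔭 => PrimarySupp a 𝔭) A)
    (Ψ : C₁ ≌ C₂)
    (hpre : ∀ ⦃X Y : C₁⦄ (φ : X ⟶ Y), PreFrobenioid.IsPreStep F₁ φ → PreFrobenioid.IsPreStep F₂ (Ψ.functor.map φ))
    (hpre' : ∀ ⦃X Y : C₂⦄ (φ : X ⟶ Y), PreFrobenioid.IsPreStep F₂ φ → PreFrobenioid.IsPreStep F₁ (Ψ.inverse.map φ))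
    (R₁ : (ofFunctor Φ₁ F₁).RSParams) (R₂ : (ofFunctor Φ₂ F₂).RSParams) :
    (ofFunctor Φ₁ F₁).Thm49 (ofFunctor Φ₂ F₂) Ψ R₁ R₂ := by
  intro hR₁ hR₂
  have hs₁ := hR₁.standard
  have hs₂ := hR₂.standard
  have hP₁ := hF₁.isPreFrobenioid
  have hP₂ := hF₂.isPreFrobenioid
  have hq₁ := hs₁.quasiIsotropic
  have hq₂ := hs₂.quasiIsotropic
  -- "Theorem 4.9 is vacuous if `C₁`, `C₂` are of group-like type": the trivial isomorphism
  by_cases hg₁ : (ofFunctor Φ₁ F₁).IsOfGroupLikeType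
  · exact nonempty_divisorMonoidIsoOver_of_isOfGroupLikeType F₁ F₂ Ψ hg₁
      ⟨fun B => (ofFunctor_isGroupLikeObj F₂ B).2 (FrdI.isGroupLikeObj_of_isBaseIso hP₂ (Ψ.counitIso.app B).hom
        (isGroupLikeObj_map_of_preservesPreSteps hF₁ hF₂ hq₁ hq₂ Ψ hpre hpre'
          ((ofFunctor_isGroupLikeObj F₁ _).1 (hg₁.obj _))))⟩
  -- non-group-like objects `N₁`, `Ψ N₁`
  obtain ⟨N₁, hN₁⟩ : ∃ A : C₁, ¬ PreFrobenioid.IsGroupLikeObj F₁ A := by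
    by_contra h
    exact hg₁ ⟨fun A => (ofFunctor_isGroupLikeObj F₁ A).2 (not_exists_not.mp h A)⟩
  have hN₂ : ¬ PreFrobenioid.IsGroupLikeObj F₂ (Ψ.functor.obj N₁) := fun h =>
    hN₁ (FrdI.isGroupLikeObj_of_isBaseIso' hP₁ (Ψ.unitIso.app N₁).hom
      (PreFrobenioid.isBaseIso_of_isIso F₁ _)
      (isGroupLikeObj_map_of_preservesPreSteps hF₂ hF₁ hq₂ hq₁ Ψ.symm (fun _ _ φ h => hpre' φ h)
        (fun _ _ φ h => hpre φ h) h))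
  -- (1) the isotropifications `C_i^istr` and the restriction `Ψ^istr` (Thm. 3.4 (i), Rmk. 4.5.1)
  haveI : (PreFrobenioid.isotropicObjects F₂).IsClosedUnderIsomorphisms :=
    ⟨fun e hX => PreFrobenioid.IsIsotropic.of_iso hP₂ e.symm hX⟩
  have hinvImg := FrdI.isotropicObjects_inverseImage hF₁ hq₁ hq₂ Ψ
  let Ψi : PreFrobenioid.Istr F₁ ≌ PreFrobenioid.Istr F₂ := Ψ.congrFullSubcategory hinvImg
  have hI₁ := PreFrobenioid.isFrobenioid_istr hF₁
  have hI₂ := PreFrobenioid.isFrobenioid_istr hF₂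
  have hsI₁ := PreFrobenioid.isOfStandardType_istr hF₁ hs₁
  have hsI₂ := PreFrobenioid.isOfStandardType_istr hF₂ hs₂
  have hNI₁ := not_isGroupLikeObj_hullIstr hF₁ hN₁
  have hNI₂ := not_isGroupLikeObj_hullIstr hF₂ hN₂
  -- `Ψ^istr` and its inverse preserve pre-steps (the pre-steps of `C^istr` are those of `C`)
  have hΨi : ∀ ⦃a b : PreFrobenioid.Istr F₁⦄ (f : a ⟶ b),
      PreFrobenioid.IsPreStep (PreFrobenioid.istrFunctor F₁) f →
        PreFrobenioid.IsPreStep (PreFrobenioid.istrFunctor F₂) (Ψi.functor.map f) :=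
    fun a b f hf => hpre f.hom hf
  have hΨi' : ∀ ⦃a b : PreFrobenioid.Istr F₂⦄ (f : a ⟶ b),
      PreFrobenioid.IsPreStep (PreFrobenioid.istrFunctor F₂) f →
        PreFrobenioid.IsPreStep (PreFrobenioid.istrFunctor F₁) (Ψi.inverse.map f) :=
    fun a b f hf => hpre' f.hom hf
  -- Thm. 3.4 (iii) for `Ψ^istr` from pre-step preservation: compatible with arrows of Frobenius type
  have hΨic : PreFrobenioid.IsFrobeniusCompatible (PreFrobenioid.istrFunctor F₁)
      (PreFrobenioid.istrFunctor F₂) Ψi.functor :=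
    isFrobeniusCompatible_of_preservesPreSteps hI₁ hI₂ hsI₁.quasiIsotropic hsI₂.quasiIsotropic hsI₁.nonDilating
      hsI₂.nonDilating Ψi (fun _ _ f h => hΨi f h) (fun _ _ f h => hΨi' f h) ⟨_, hNI₁⟩ ⟨_, hNI₂⟩
  -- (2) the setting at the perfections `(C_i^istr)^pf`, from the PRINTED hypotheses on `C_i^istr`
  have hTI : Thm42Setting (ofFunctor Φ₁ (PreFrobenioid.istrFunctor F₁)) (ofFunctor Φ₂ (PreFrobenioid.istrFunctor F₂)) :=
    ⟨⟨hsI₁, hsI₂⟩, ⟨(ofFunctor_isOfIsotropicType _).2 PreFrobenioid.isOfIsotropicType_istr,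
      (ofFunctor_isOfIsotropicType _).2 PreFrobenioid.isOfIsotropicType_istr⟩,
      ⟨fun h => hNI₁ ((ofFunctor_isGroupLikeObj _ _).1 (h.obj _)),
        fun h => hNI₂ ((ofFunctor_isGroupLikeObj _ _).1 (h.obj _))⟩⟩
  haveI := PreFrobenioid.Perfection.map_isEquivalence (hF₁ := hI₁) (hF₂ := hI₂) Ψi hΨic
  have S := FrdI.T42.settingWeak_perfection_asPrinted Ψi hI₁ hI₂ hpf₁ hpf₂ hTI hΨic
  have hPf₁ := PreFrobenioid.Perfection.isFrobenioid hI₁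
    (FrdI.T42.isFrobeniusIsotropic_of_isOfIsotropicType hI₁ PreFrobenioid.isOfIsotropicType_istr)
  have hndp₂ : IsNonDilatingOn (PreFrobenioid.Perfection.ops hI₂).monFunctor :=
    FrdI.isNonDilatingOn_of_ofFunctor (F := (PreFrobenioid.Perfection.ops hI₂).toFunctor)
      (PreFrobenioid.Perfection.isNonDilatingOn_ops hI₂ hsI₂.nonDilating)
  -- Rmk. 4.5.1: `C₁^istr` is of rational type; Prop. 5.5 (iii): so is `(C₁^istr)^pf`
  have hratI : ∀ A : PreFrobenioid.Istr F₁, PreFrobenioidData.IsRational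
      (PreFrobenioid.biratData hI₁ (PreFrobenioid.hasBiratSquares_of_isFrobenioid hI₁))
      (S := ofFunctor Φ₁ (PreFrobenioid.istrFunctor F₁)) (fun a 𝔭 => PrimarySupp a 𝔭) A :=
    fun A => PreFrobenioid.isRational_istr_of hF₁ hrat₁ A
  have hratP : ∀ ⦃X : PreFrobenioid.Perfection hI₁⦄,
      PreFrobenioid.IsUniversallyDivFrobeniusTrivial (PreFrobenioid.Perfection.ops hI₁).toFunctor X →
        PreFrobenioidData.IsRational (PreFrobenioid.biratData S.isFrobenioid₁
          (PreFrobenioid.hasBiratSquares_of_isFrobenioid S.isFrobenioid₁))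
          (S := ofFunctor _ (PreFrobenioid.Perfection.ops hI₁).toFunctor) (fun a 𝔭 => PrimarySupp a 𝔭) X :=
    fun X _ => PreFrobenioid.Perfection.isRational_perfection_of hI₁ hPf₁ hratI X
  -- (3) Thm. 4.9 at the perfect-isotropic level (rows T49-L02/L05/L06/L07/L08′ with `Ψ^Prime`)
  obtain ⟨E', -, -, hE', -⟩ := exists_thm49_compat_perfect_primarySupp_weak S hndp₂ hratP
  -- (4) descent along `Φ_i ↪ Φ_i^pf` to the isotropifications
  obtain ⟨EI⟩ := nonempty_divisorMonoidIsoOver_of_perfection hI₁ hI₂ Ψi hΨic hΨi' E'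
    (fun X Y f hf => hE' f hf)
  -- (5) extension along isotropic hulls (row T49-L01)
  exact nonempty_divisorMonoidIsoOver_of_isotropic F₁ F₂ Ψ hF₁ hF₂
    (fun A hA => FrdI.isIsotropic_map hq₁ hq₂ Ψ hA)
    (fun A B h hh => FrdI.isIsotropicHull_map hF₁ hF₂ hq₁ hq₂ Ψ hh)
    (fun A hA => EI.iso ⟨A, hA⟩)
    (fun A B hA hB φ x =>
      EI.natural (A := (⟨A, hA⟩ : PreFrobenioid.Istr F₁)) (B := ⟨B, hB⟩) (ObjectProperty.homMk φ) x)

end FrdI.T49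

end Literature.AlgebraicGeometry.Frobenioids
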